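import Mathlib
import HarnessLib
import Summits.Ventures.LatticeQCDFlow.Exactness.EngineHMCTranslationCovariance
import Summits.Ventures.LatticeQCDFlow.Exactness.OpenBoundaryProfile
import Summits.Ventures.LatticeQCDFlow.Scoring.TranslationAverageTwoPoint

/-!
# Observables along the engine's HMC runs at every step: homogeneous one-point functions and `E[Q²] = |Λ| Σ_v E[q_0 q_v]` on the periodic run; energy profile and slab-charge second moments on the open-boundary run

HONEST FRAMING: exact (Metropolis-corrected) sampling algorithms for lattice gauge theory;
figures of merit are autocorrelation/cost numbers at stated couplings and volumes; no
continuum-physics claim.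

Venture `LatticeQCDFlow` (cell pub-lqcd), topic `Exactness`, FANOUT row 21 (`su3-base`, arms `E2 = PBC-HMC` and `OBC-HMC` AS RUN,
row 9's engine kernel `sunLeapfrogHMCN` with row 21's forces).  NEW WORK of the cell: the observables of row 21's
`Scoring/TranslationAverageTwoPoint` (site fields under translation-invariant laws), `Scoring/FlowedEnergyLatticeSymmetry`
(`t²E`) and `Exactness/OpenBoundaryProfile` (profiles, slab sums) read along the RUNS, using `EngineHMCTranslationCovariance`
(the `t`-step laws from the cold / hot start are translation invariant — all translations on the periodic run, those orthogonal
to `τ` on the open-boundary run).  Def-free; nothing is cited as a fact; no number.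

* §1 `coe_torusConfigShift_eq_configTranslate_neg` (the Literature's `τ_v` is `T_{−v}`); the Markov property of the engine kernel
  is obtained inline (as in row 21's `EngineHMCReversible`).
* §2 PERIODIC RUN, every step `t`, cold or hot start: `wilsonHmcChain_law_map_torusConfigShift`;
  **`integral_sq_rk3CloverCharge_wilsonHmcChain`** — `E_t[Q²] = |Λ| Σ_v E_t[q_0 q_v]` for the measured charge `Q = Σ_x P_x ∘ RK3^m`;
  **`integral_sq_rk3CloverEnergy_wilsonHmcChain`** (the same for the measured total energy) and
  `integral_rk3CloverEnergy_wilsonHmcChain_eq_origin` (`E_t[E_x] = E_t[E_0]`).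
* §3 OPEN-BOUNDARY RUN, every step `t`, cold or hot start: **`integral_obcHmcChain_cloverEnergy_eq_of_apply_eq`** (the bare clover
  energy density one-point function is a PROFILE in the open coordinate) and **`integral_obcHmcChain_slabCharge_mul_slabCharge`**
  (slab-charge second moments reduce to one reference site: `E_t[Q_s Q_{s'}] = |Λ_s| Σ_{y∈Λ_{s'}} E_t[P_{s e_τ} P_y]`).
NOT CLAIMED: stationarity or convergence rates (see `SUNWilsonHMCErgodic` / `OpenBoundaryHMCForce`); flowed observables on the
open-boundary run (the periodic `wilsonFlowRK3` is not the open-boundary flow); numbers.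
-/

noncomputable section

namespace Summit.Ventures.LatticeQCDFlow.Exactness

open MeasureTheory ProbabilityTheory ProbabilityTheory.Kernel Set Function
open Literature.MathematicalPhysics.QuantumFieldTheory
open Literature.MathematicalPhysics.QuantumLattice (fundamentalRep continuous_fundamentalRep cloverPseudoscalar
  continuous_cloverPseudoscalar flowedCloverEnergy continuous_flowedCloverEnergy_zero measurable_cloverPseudoscalar
  exists_abs_cloverPseudoscalar_le)
open scoped ENNReal Matrix

set_option backward.isDefEq.respectTransparency false

/-! ## §1 Dictionary and the Markov property -/

section Dictionary

variable {d L : ℕ} {G : Type*} [MeasurableSpace G]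

/-- The Literature's torus shift `τ_v` (`(τ_v U)(x,i) = U(x − v, i)`) is the translation `T_{−v}` as a map. -/
theorem coe_torusConfigShift_eq_configTranslate_neg (v : Site d L) :
    (⇑(TorusTranslation.torusConfigShift (G := G) v) : GaugeConfig d L G → GaugeConfig d L G) = ⇑(configTranslate (G := G) (-v)) := by
  funext U e
  rw [TorusTranslation.torusConfigShift_apply, configTranslate_apply_edge, sub_eq_add_neg, add_comm]

/-- A law invariant under every `T_v` is invariant under every `τ_v`. -/
theorem map_torusConfigShift_of_configTranslate {μ : Measure (GaugeConfig d L G)}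
    (hμ : ∀ v : Site d L, μ.map (configTranslate v) = μ) (v : Site d L) :
    μ.map (TorusTranslation.torusConfigShift v) = μ := by
  rw [coe_torusConfigShift_eq_configTranslate_neg]
  exact hμ (-v)

end Dictionary


/-! ## §2 The periodic run at every step -/

section Periodic

variable (N : ℕ) {L : ℕ} [NeZero L]

/-- The `t`-step law of the periodic run from a start invariant under every `T_v` is invariant under every `τ_v`. -/
theorem wilsonHmcChain_law_map_torusConfigShift {d : ℕ} (β ε : ℝ) (nstep : ℕ)
    {μ₀ : Measure (GaugeConfig d L (Matrix.specialUnitaryGroup (Fin N) ℂ))} (hμ₀ : ∀ v : Site d L, μ₀.map (configTranslate v) = μ₀)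
    (t : ℕ) (v : Site d L) :
    (μ₀.bind (nHit (sunLeapfrogHMCN (sunCoordι N) (sunCoordι_skew N) ε (Measure.addHaar : Measure (SUNCoords N)) (sunKinetic N)
        (measurable_halfKick_sun N (measurable_sunWilsonForce N (d := d) (L := L) β) ε)
        (fun U => β * wilsonAction (suRep N) U) nstep) t)).map (TorusTranslation.torusConfigShift v) =
      μ₀.bind (nHit (sunLeapfrogHMCN (sunCoordι N) (sunCoordι_skew N) ε (Measure.addHaar : Measure (SUNCoords N)) (sunKinetic N)
        (measurable_halfKick_sun N (measurable_sunWilsonForce N (d := d) (L := L) β) ε)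
        (fun U => β * wilsonAction (suRep N) U) nstep) t) :=
  map_torusConfigShift_of_configTranslate (fun w => wilsonHmcChain_law_map_configTranslate N β ε nstep w (hμ₀ w) t) v

/-- **`E_t[Q²] = |Λ| Σ_v E_t[q_0 q_v]` AT EVERY STEP OF THE PERIODIC RUN** from any probability start invariant under all
translations, for the measured charge density `q_x = P_x ∘ RK3_{ε'}^m` (`SU(N)`, fundamental representation, `d = 4`). -/
theorem integral_sq_rk3CloverCharge_wilsonHmcChain (β ε : ℝ) (nstep : ℕ)
    {μ₀ : Measure (GaugeConfig 4 L (Matrix.specialUnitaryGroup (Fin N) ℂ))} [IsProbabilityMeasure μ₀]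
    (hμ₀ : ∀ v : Site 4 L, μ₀.map (configTranslate v) = μ₀) (t : ℕ) (ε' : ℝ) (m : ℕ) :
    ∫ U, (∑ x : Site 4 L, cloverPseudoscalar (fundamentalRep (Fin N)) x ((Scoring.wilsonFlowRK3 ε')^[m] U)) ^ 2
        ∂(μ₀.bind (nHit (sunLeapfrogHMCN (sunCoordι N) (sunCoordι_skew N) ε (Measure.addHaar : Measure (SUNCoords N)) (sunKinetic N)
          (measurable_halfKick_sun N (measurable_sunWilsonForce N (d := 4) (L := L) β) ε)
          (fun U => β * wilsonAction (suRep N) U) nstep) t)) =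
      (Fintype.card (Site 4 L) : ℝ) * ∑ v : Site 4 L,
        ∫ U, cloverPseudoscalar (fundamentalRep (Fin N)) 0 ((Scoring.wilsonFlowRK3 ε')^[m] U) *
            cloverPseudoscalar (fundamentalRep (Fin N)) v ((Scoring.wilsonFlowRK3 ε')^[m] U)
          ∂(μ₀.bind (nHit (sunLeapfrogHMCN (sunCoordι N) (sunCoordι_skew N) ε (Measure.addHaar : Measure (SUNCoords N))
            (sunKinetic N) (measurable_halfKick_sun N (measurable_sunWilsonForce N (d := 4) (L := L) β) ε)
            (fun U => β * wilsonAction (suRep N) U) nstep) t)) := by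
  haveI : IsMarkovKernel (sunLeapfrogHMCN (sunCoordι N) (sunCoordι_skew N) ε (Measure.addHaar : Measure (SUNCoords N))
      (sunKinetic N) (measurable_halfKick_sun N (measurable_sunWilsonForce N (d := 4) (L := L) β) ε)
      (fun U => β * wilsonAction (suRep N) U) nstep) := by
    haveI : Fact (Measurable fun z : GaugeConfig 4 L (Matrix.specialUnitaryGroup (Fin N) ℂ) × (Edge 4 L → SUNCoords N) =>
        β * wilsonAction (suRep N) z.1 + sunKinetic N z.2) :=
      ⟨((continuous_smul_wilsonAction (suRep N) continuous_suRep β).measurable.comp measurable_fst).add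
        ((measurable_sunKinetic N).comp measurable_snd)⟩
    haveI := isProbabilityMeasure_sunMomentumLaw (L := Edge 4 L) (Measure.addHaar : Measure (SUNCoords N)) (sunKinetic N)
      (measurable_sunKinetic N) (sunMomentumWeight_sunKinetic_ne_top N Measure.addHaar)
    unfold sunLeapfrogHMCN; infer_instance
  haveI := isMarkovKernel_nHit (sunLeapfrogHMCN (sunCoordι N) (sunCoordι_skew N) ε (Measure.addHaar : Measure (SUNCoords N))
    (sunKinetic N) (measurable_halfKick_sun N (measurable_sunWilsonForce N (d := 4) (L := L) β) ε)
    (fun U => β * wilsonAction (suRep N) U) nstep) t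
  exact Scoring.integral_sq_sum_siteField (wilsonHmcChain_law_map_torusConfigShift N β ε nstep hμ₀ t)
    (fun x U => cloverPseudoscalar (fundamentalRep (Fin N)) x ((Scoring.wilsonFlowRK3 ε')^[m] U))
    (fun v x U => Scoring.rk3CloverDensity_torusConfigShift ε' m v x U)
    fun x y => Scoring.integrable_of_continuous_sunConfig (Scoring.continuous_rk3CloverDensity_mul ε' m x y)

/-- **`E_t[(ΣE)²] = |Λ| Σ_v E_t[E_0 E_v]` at every step of the periodic run** for the measured energy density `E_x ∘ RK3^m`. -/
theorem integral_sq_rk3CloverEnergy_wilsonHmcChain (β ε : ℝ) (nstep : ℕ)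
    {μ₀ : Measure (GaugeConfig 4 L (Matrix.specialUnitaryGroup (Fin N) ℂ))} [IsProbabilityMeasure μ₀]
    (hμ₀ : ∀ v : Site 4 L, μ₀.map (configTranslate v) = μ₀) (t : ℕ) (ε' : ℝ) (m : ℕ) :
    ∫ U, (∑ x : Site 4 L, flowedCloverEnergy (fundamentalRep (Fin N)) 0 x ((Scoring.wilsonFlowRK3 ε')^[m] U)) ^ 2
        ∂(μ₀.bind (nHit (sunLeapfrogHMCN (sunCoordι N) (sunCoordι_skew N) ε (Measure.addHaar : Measure (SUNCoords N)) (sunKinetic N)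
          (measurable_halfKick_sun N (measurable_sunWilsonForce N (d := 4) (L := L) β) ε)
          (fun U => β * wilsonAction (suRep N) U) nstep) t)) =
      (Fintype.card (Site 4 L) : ℝ) * ∑ v : Site 4 L,
        ∫ U, flowedCloverEnergy (fundamentalRep (Fin N)) 0 0 ((Scoring.wilsonFlowRK3 ε')^[m] U) *
            flowedCloverEnergy (fundamentalRep (Fin N)) 0 v ((Scoring.wilsonFlowRK3 ε')^[m] U)
          ∂(μ₀.bind (nHit (sunLeapfrogHMCN (sunCoordι N) (sunCoordι_skew N) ε (Measure.addHaar : Measure (SUNCoords N))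
            (sunKinetic N) (measurable_halfKick_sun N (measurable_sunWilsonForce N (d := 4) (L := L) β) ε)
            (fun U => β * wilsonAction (suRep N) U) nstep) t)) := by
  haveI : IsMarkovKernel (sunLeapfrogHMCN (sunCoordι N) (sunCoordι_skew N) ε (Measure.addHaar : Measure (SUNCoords N))
      (sunKinetic N) (measurable_halfKick_sun N (measurable_sunWilsonForce N (d := 4) (L := L) β) ε)
      (fun U => β * wilsonAction (suRep N) U) nstep) := by
    haveI : Fact (Measurable fun z : GaugeConfig 4 L (Matrix.specialUnitaryGroup (Fin N) ℂ) × (Edge 4 L → SUNCoords N) =>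
        β * wilsonAction (suRep N) z.1 + sunKinetic N z.2) :=
      ⟨((continuous_smul_wilsonAction (suRep N) continuous_suRep β).measurable.comp measurable_fst).add
        ((measurable_sunKinetic N).comp measurable_snd)⟩
    haveI := isProbabilityMeasure_sunMomentumLaw (L := Edge 4 L) (Measure.addHaar : Measure (SUNCoords N)) (sunKinetic N)
      (measurable_sunKinetic N) (sunMomentumWeight_sunKinetic_ne_top N Measure.addHaar)
    unfold sunLeapfrogHMCN; infer_instance
  haveI := isMarkovKernel_nHit (sunLeapfrogHMCN (sunCoordι N) (sunCoordι_skew N) ε (Measure.addHaar : Measure (SUNCoords N))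
    (sunKinetic N) (measurable_halfKick_sun N (measurable_sunWilsonForce N (d := 4) (L := L) β) ε)
    (fun U => β * wilsonAction (suRep N) U) nstep) t
  exact Scoring.integral_sq_sum_siteField (wilsonHmcChain_law_map_torusConfigShift N β ε nstep hμ₀ t)
    (fun x U => flowedCloverEnergy (fundamentalRep (Fin N)) 0 x ((Scoring.wilsonFlowRK3 ε')^[m] U))
    (fun v x U => Scoring.rk3CloverEnergy_torusConfigShift ε' m v x U)
    fun x y => Scoring.integrable_of_continuous_sunConfig
      ((Scoring.continuous_rk3CloverEnergy ε' m x).mul (Scoring.continuous_rk3CloverEnergy ε' m y))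

/-- **`E_t[E_x] = E_t[E_0]` at every step of the periodic run**: the measured energy density one-point function is homogeneous. -/
theorem integral_rk3CloverEnergy_wilsonHmcChain_eq_origin (β ε : ℝ) (nstep : ℕ)
    {μ₀ : Measure (GaugeConfig 4 L (Matrix.specialUnitaryGroup (Fin N) ℂ))} (hμ₀ : ∀ v : Site 4 L, μ₀.map (configTranslate v) = μ₀)
    (t : ℕ) (ε' : ℝ) (m : ℕ) (x : Site 4 L) :
    ∫ U, flowedCloverEnergy (fundamentalRep (Fin N)) 0 x ((Scoring.wilsonFlowRK3 ε')^[m] U)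
        ∂(μ₀.bind (nHit (sunLeapfrogHMCN (sunCoordι N) (sunCoordι_skew N) ε (Measure.addHaar : Measure (SUNCoords N)) (sunKinetic N)
          (measurable_halfKick_sun N (measurable_sunWilsonForce N (d := 4) (L := L) β) ε)
          (fun U => β * wilsonAction (suRep N) U) nstep) t)) =
      ∫ U, flowedCloverEnergy (fundamentalRep (Fin N)) 0 0 ((Scoring.wilsonFlowRK3 ε')^[m] U)
        ∂(μ₀.bind (nHit (sunLeapfrogHMCN (sunCoordι N) (sunCoordι_skew N) ε (Measure.addHaar : Measure (SUNCoords N)) (sunKinetic N)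
          (measurable_halfKick_sun N (measurable_sunWilsonForce N (d := 4) (L := L) β) ε)
          (fun U => β * wilsonAction (suRep N) U) nstep) t)) :=
  Scoring.integral_siteField_eq_origin (wilsonHmcChain_law_map_torusConfigShift N β ε nstep hμ₀ t)
    (fun x U => flowedCloverEnergy (fundamentalRep (Fin N)) 0 x ((Scoring.wilsonFlowRK3 ε')^[m] U))
    (fun v x U => Scoring.rk3CloverEnergy_torusConfigShift ε' m v x U) x

/-- Cold start: `E_t[Q²] = |Λ| Σ_v E_t[q_0 q_v]` at every step of the periodic run. -/
theorem integral_sq_rk3CloverCharge_wilsonHmcColdStart (β ε : ℝ) (nstep t : ℕ) (ε' : ℝ) (m : ℕ) :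
    ∫ U, (∑ x : Site 4 L, cloverPseudoscalar (fundamentalRep (Fin N)) x ((Scoring.wilsonFlowRK3 ε')^[m] U)) ^ 2
        ∂((Measure.dirac (1 : GaugeConfig 4 L (Matrix.specialUnitaryGroup (Fin N) ℂ))).bind (nHit (sunLeapfrogHMCN (sunCoordι N)
          (sunCoordι_skew N) ε (Measure.addHaar : Measure (SUNCoords N)) (sunKinetic N)
          (measurable_halfKick_sun N (measurable_sunWilsonForce N (d := 4) (L := L) β) ε)
          (fun U => β * wilsonAction (suRep N) U) nstep) t)) =
      (Fintype.card (Site 4 L) : ℝ) * ∑ v : Site 4 L,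
        ∫ U, cloverPseudoscalar (fundamentalRep (Fin N)) 0 ((Scoring.wilsonFlowRK3 ε')^[m] U) *
            cloverPseudoscalar (fundamentalRep (Fin N)) v ((Scoring.wilsonFlowRK3 ε')^[m] U)
          ∂((Measure.dirac (1 : GaugeConfig 4 L (Matrix.specialUnitaryGroup (Fin N) ℂ))).bind (nHit (sunLeapfrogHMCN (sunCoordι N)
            (sunCoordι_skew N) ε (Measure.addHaar : Measure (SUNCoords N)) (sunKinetic N)
            (measurable_halfKick_sun N (measurable_sunWilsonForce N (d := 4) (L := L) β) ε)
            (fun U => β * wilsonAction (suRep N) U) nstep) t)) :=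
  integral_sq_rk3CloverCharge_wilsonHmcChain N β ε nstep (fun v => dirac_one_map_configTranslate N v) t ε' m

/-- Hot start: `E_t[Q²] = |Λ| Σ_v E_t[q_0 q_v]` at every step of the periodic run. -/
theorem integral_sq_rk3CloverCharge_wilsonHmcHotStart (β ε : ℝ) (nstep t : ℕ) (ε' : ℝ) (m : ℕ) :
    ∫ U, (∑ x : Site 4 L, cloverPseudoscalar (fundamentalRep (Fin N)) x ((Scoring.wilsonFlowRK3 ε')^[m] U)) ^ 2
        ∂((Measure.pi fun _ : Edge 4 L => haarProbability (Matrix.specialUnitaryGroup (Fin N) ℂ)).bind (nHit (sunLeapfrogHMCN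
          (sunCoordι N) (sunCoordι_skew N) ε (Measure.addHaar : Measure (SUNCoords N)) (sunKinetic N)
          (measurable_halfKick_sun N (measurable_sunWilsonForce N (d := 4) (L := L) β) ε)
          (fun U => β * wilsonAction (suRep N) U) nstep) t)) =
      (Fintype.card (Site 4 L) : ℝ) * ∑ v : Site 4 L,
        ∫ U, cloverPseudoscalar (fundamentalRep (Fin N)) 0 ((Scoring.wilsonFlowRK3 ε')^[m] U) *
            cloverPseudoscalar (fundamentalRep (Fin N)) v ((Scoring.wilsonFlowRK3 ε')^[m] U)
          ∂((Measure.pi fun _ : Edge 4 L => haarProbability (Matrix.specialUnitaryGroup (Fin N) ℂ)).bind (nHit (sunLeapfrogHMCN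
            (sunCoordι N) (sunCoordι_skew N) ε (Measure.addHaar : Measure (SUNCoords N)) (sunKinetic N)
            (measurable_halfKick_sun N (measurable_sunWilsonForce N (d := 4) (L := L) β) ε)
            (fun U => β * wilsonAction (suRep N) U) nstep) t)) :=
  integral_sq_rk3CloverCharge_wilsonHmcChain N β ε nstep (fun v => piHaar_map_configTranslate N v) t ε' m

end Periodic

/-! ## §3 The open-boundary run at every step -/

section OpenBoundary

variable (N : ℕ) {d L : ℕ} [NeZero L]

/-- **THE ENERGY DENSITY ONE-POINT FUNCTION OF THE OPEN-BOUNDARY RUN IS A PROFILE AT EVERY STEP**: from any start invariant under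
the translations orthogonal to `τ` (cold and hot starts are), `E_t[E_x] = E_t[E_y]` whenever `x_τ = y_τ` (bare clover energy,
any `d`). -/
theorem integral_obcHmcChain_cloverEnergy_eq_of_apply_eq (τ : Fin d) (β ε : ℝ) (nstep : ℕ)
    {μ₀ : Measure (GaugeConfig d L (Matrix.specialUnitaryGroup (Fin N) ℂ))}
    (hμ₀ : ∀ v : Site d L, v τ = 0 → μ₀.map (configTranslate v) = μ₀) (t : ℕ) {x y : Site d L} (hxy : x τ = y τ) :
    ∫ U, flowedCloverEnergy (suRep N) 0 x U ∂(μ₀.bind (nHit (sunLeapfrogHMCN (sunCoordι N) (sunCoordι_skew N) ε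
        (Measure.addHaar : Measure (SUNCoords N)) (sunKinetic N)
        (measurable_halfKick_sun N (measurable_sunWeightedForce N (d := d) (L := L) (obcWeight τ) β) ε)
        (fun U => β * obcAction (suRep N) τ U) nstep) t)) =
      ∫ U, flowedCloverEnergy (suRep N) 0 y U ∂(μ₀.bind (nHit (sunLeapfrogHMCN (sunCoordι N) (sunCoordι_skew N) ε
        (Measure.addHaar : Measure (SUNCoords N)) (sunKinetic N)
        (measurable_halfKick_sun N (measurable_sunWeightedForce N (d := d) (L := L) (obcWeight τ) β) ε)
        (fun U => β * obcAction (suRep N) τ U) nstep) t)) :=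
  integral_siteField_eq_of_apply_eq (fun v hv => obcHmcChain_law_map_configTranslate N τ β ε nstep hv (hμ₀ v hv) t)
    (fun x U => flowedCloverEnergy (suRep N) 0 x U) (fun v x U => flowedCloverEnergy_zero_configTranslate (suRep N) v x U) hxy

/-- **SLAB-CHARGE SECOND MOMENTS ALONG THE OPEN-BOUNDARY RUN**: from any probability start invariant under the translations
orthogonal to `τ`, at every step `t`, `E_t[Q_s Q_{s'}] = |Λ_s| · Σ_{y∈Λ_{s'}} E_t[P_{s e_τ} P_y]` for the slab charges
`Q_s = Σ_{x : x_τ = s} P_x` of the bare clover density (`d = 4`). -/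
theorem integral_obcHmcChain_slabCharge_mul_slabCharge (τ : Fin 4) (β ε : ℝ) (nstep : ℕ)
    {μ₀ : Measure (GaugeConfig 4 L (Matrix.specialUnitaryGroup (Fin N) ℂ))} [IsProbabilityMeasure μ₀]
    (hμ₀ : ∀ v : Site 4 L, v τ = 0 → μ₀.map (configTranslate v) = μ₀) (t : ℕ) (s s' : ZMod L) :
    ∫ U, (∑ x ∈ Finset.univ.filter (fun z : Site 4 L => z τ = s), cloverPseudoscalar (suRep N) x U) *
        (∑ y ∈ Finset.univ.filter (fun z : Site 4 L => z τ = s'), cloverPseudoscalar (suRep N) y U)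
        ∂(μ₀.bind (nHit (sunLeapfrogHMCN (sunCoordι N) (sunCoordι_skew N) ε (Measure.addHaar : Measure (SUNCoords N)) (sunKinetic N)
          (measurable_halfKick_sun N (measurable_sunWeightedForce N (d := 4) (L := L) (obcWeight τ) β) ε)
          (fun U => β * obcAction (suRep N) τ U) nstep) t)) =
      ((Finset.univ.filter fun z : Site 4 L => z τ = s).card : ℝ) *
        ∑ y ∈ Finset.univ.filter (fun z : Site 4 L => z τ = s'),
          ∫ U, cloverPseudoscalar (suRep N) (Pi.single τ s) U * cloverPseudoscalar (suRep N) y U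
            ∂(μ₀.bind (nHit (sunLeapfrogHMCN (sunCoordι N) (sunCoordι_skew N) ε (Measure.addHaar : Measure (SUNCoords N))
              (sunKinetic N) (measurable_halfKick_sun N (measurable_sunWeightedForce N (d := 4) (L := L) (obcWeight τ) β) ε)
              (fun U => β * obcAction (suRep N) τ U) nstep) t)) := by
  haveI : IsMarkovKernel (sunLeapfrogHMCN (sunCoordι N) (sunCoordι_skew N) ε (Measure.addHaar : Measure (SUNCoords N))
      (sunKinetic N) (measurable_halfKick_sun N (measurable_sunWeightedForce N (d := 4) (L := L) (obcWeight τ) β) ε)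
      (fun U => β * obcAction (suRep N) τ U) nstep) := by
    haveI : Fact (Measurable fun z : GaugeConfig 4 L (Matrix.specialUnitaryGroup (Fin N) ℂ) × (Edge 4 L → SUNCoords N) =>
        β * obcAction (suRep N) τ z.1 + sunKinetic N z.2) :=
      ⟨(((continuous_obcAction (suRep N) continuous_suRep τ).measurable.const_mul β).comp measurable_fst).add
        ((measurable_sunKinetic N).comp measurable_snd)⟩
    haveI := isProbabilityMeasure_sunMomentumLaw (L := Edge 4 L) (Measure.addHaar : Measure (SUNCoords N)) (sunKinetic N)
      (measurable_sunKinetic N) (sunMomentumWeight_sunKinetic_ne_top N Measure.addHaar)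
    unfold sunLeapfrogHMCN; infer_instance
  haveI := isMarkovKernel_nHit (sunLeapfrogHMCN (sunCoordι N) (sunCoordι_skew N) ε (Measure.addHaar : Measure (SUNCoords N))
    (sunKinetic N) (measurable_halfKick_sun N (measurable_sunWeightedForce N (d := 4) (L := L) (obcWeight τ) β) ε)
    (fun U => β * obcAction (suRep N) τ U) nstep) t
  refine integral_slabSum_mul_slabSum (fun v hv => obcHmcChain_law_map_configTranslate N τ β ε nstep hv (hμ₀ v hv) t) _ _
    (fun v x U => cloverPseudoscalar_configTranslate (suRep N) v x U) (fun v x U => cloverPseudoscalar_configTranslate (suRep N) v x U)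
    (fun x y => ?_) s s'
  exact Scoring.integrable_of_continuous_sunConfig
    ((continuous_cloverPseudoscalar (suRep N) continuous_suRep x).mul (continuous_cloverPseudoscalar (suRep N) continuous_suRep y))

/-- Cold start of the open-boundary run: the energy density one-point function is a profile at every step. -/
theorem integral_obcHmcColdStart_cloverEnergy_eq_of_apply_eq (τ : Fin d) (β ε : ℝ) (nstep t : ℕ) {x y : Site d L}
    (hxy : x τ = y τ) :
    ∫ U, flowedCloverEnergy (suRep N) 0 x U ∂((Measure.dirac (1 : GaugeConfig d L (Matrix.specialUnitaryGroup (Fin N) ℂ))).bind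
        (nHit (sunLeapfrogHMCN (sunCoordι N) (sunCoordι_skew N) ε (Measure.addHaar : Measure (SUNCoords N)) (sunKinetic N)
        (measurable_halfKick_sun N (measurable_sunWeightedForce N (d := d) (L := L) (obcWeight τ) β) ε)
        (fun U => β * obcAction (suRep N) τ U) nstep) t)) =
      ∫ U, flowedCloverEnergy (suRep N) 0 y U ∂((Measure.dirac (1 : GaugeConfig d L (Matrix.specialUnitaryGroup (Fin N) ℂ))).bind
        (nHit (sunLeapfrogHMCN (sunCoordι N) (sunCoordι_skew N) ε (Measure.addHaar : Measure (SUNCoords N)) (sunKinetic N)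
        (measurable_halfKick_sun N (measurable_sunWeightedForce N (d := d) (L := L) (obcWeight τ) β) ε)
        (fun U => β * obcAction (suRep N) τ U) nstep) t)) :=
  integral_obcHmcChain_cloverEnergy_eq_of_apply_eq N τ β ε nstep (fun v _ => dirac_one_map_configTranslate N v) t hxy

/-- Cold start of the open-boundary run: slab-charge second moments reduce to one reference site at every step (`d = 4`). -/
theorem integral_obcHmcColdStart_slabCharge_mul_slabCharge (τ : Fin 4) (β ε : ℝ) (nstep t : ℕ) (s s' : ZMod L) :
    ∫ U, (∑ x ∈ Finset.univ.filter (fun z : Site 4 L => z τ = s), cloverPseudoscalar (suRep N) x U) *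
        (∑ y ∈ Finset.univ.filter (fun z : Site 4 L => z τ = s'), cloverPseudoscalar (suRep N) y U)
        ∂((Measure.dirac (1 : GaugeConfig 4 L (Matrix.specialUnitaryGroup (Fin N) ℂ))).bind (nHit (sunLeapfrogHMCN (sunCoordι N)
          (sunCoordι_skew N) ε (Measure.addHaar : Measure (SUNCoords N)) (sunKinetic N)
          (measurable_halfKick_sun N (measurable_sunWeightedForce N (d := 4) (L := L) (obcWeight τ) β) ε)
          (fun U => β * obcAction (suRep N) τ U) nstep) t)) =
      ((Finset.univ.filter fun z : Site 4 L => z τ = s).card : ℝ) *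
        ∑ y ∈ Finset.univ.filter (fun z : Site 4 L => z τ = s'),
          ∫ U, cloverPseudoscalar (suRep N) (Pi.single τ s) U * cloverPseudoscalar (suRep N) y U
            ∂((Measure.dirac (1 : GaugeConfig 4 L (Matrix.specialUnitaryGroup (Fin N) ℂ))).bind (nHit (sunLeapfrogHMCN
              (sunCoordι N) (sunCoordι_skew N) ε (Measure.addHaar : Measure (SUNCoords N)) (sunKinetic N)
              (measurable_halfKick_sun N (measurable_sunWeightedForce N (d := 4) (L := L) (obcWeight τ) β) ε)
              (fun U => β * obcAction (suRep N) τ U) nstep) t)) :=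
  integral_obcHmcChain_slabCharge_mul_slabCharge N τ β ε nstep (fun v _ => dirac_one_map_configTranslate N v) t s s'

end OpenBoundary

end Summit.Ventures.LatticeQCDFlow.Exactness
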